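import Summits.PneNP.PneNP.Theorems.ExpanderLinearGeneratorsExpansionForcesDepthFregeSizeTseitinWeak
import Literature.Computability.MetaComplexity.TseitinDepthFregeWallLowerBound

/-!
# PneNP / ExpanderLinearGenerators — the expansion-scale law at column weight two, conditionally
# on the polynomial excluded-grid theorem alone (stmt-PneNP-11442, slice)

Route `PneNP/ExpanderLinearGenerators`, crux stmt-PneNP-11442
(`Summit.PneNP.PneNP.Theses.ExpanderLinearGenerators.ExpansionForcesDepthFregeSize`). The sibling
file `…ExpansionForcesDepthFregeSizeTseitin` obtains the column-weight-two (connected graph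
Tseitin) slice of the crux from the Galesi–Itsykson–Riazanov–Sofronova bound, a named fact whose
printed proof rests on Håstad's grid switching lemma AND the polynomial excluded-grid theorem.
Here the proof-complexity input is removed: the slice follows from the polynomial excluded-grid
theorem in wall form with ANY exponent (W_δ) alone, through the tree's unconditional weak grid
theorem (`gridSystem_depthFrege_lowerBound`, by the pigeonhole reduction), the GIRS reduction
(`exists_gridRefutation`) and the weak treewidth bound
(`tseitin_treewidth_depthFrege_lowerBound_of_wall`), composed with
`expansionForcesDepthFregeSize_tseitin_of_weakTreewidthBound`.

* `expansionForcesDepthFregeSize_tseitin_of_excludedGrid` — the column-weight-two connected slice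
  of the crux from (W_δ) only ((W_δ) is the explicit hypothesis, as in the Literature files: graphs
  of large treewidth `t` contain the wall `W_r`, `r ≥ c · t^δ`, as a topological minor; GIRS Cor. 9
  from Chuzhoy–Tan Thm. 1.1 gives `δ = 1/10`).

References: N. Galesi, D. Itsykson, A. Riazanov, A. Sofronova, APAL 174 (2023), Thm. 8, Cor. 9,
Thm. 18; J. Chuzhoy, Z. Tan, JCTB 146 (2021), Thm. 1.1; J. Krajíček, *Proof complexity* (CUP
2019), §13.4, Problem 19.4.5.
-/

namespace Summit.PneNP.PneNP.Theorems

set_option linter.dupNamespace false -- `Summit.PneNP.PneNP.…`: summit = sub-problem (D-0017)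

open Finset Literature.Computability.MetaComplexity Literature.Computability.Complexity
  Literature.Combinatorics.SimpleGraph

/-- **The column-weight-two slice of the expansion-scale law from the polynomial excluded-grid
theorem alone.** Assume (W_δ): every finite graph of treewidth `t ≥ t₁` has the wall `W_r`,
`r ≥ c · t^δ`, as a topological minor, for some `δ, c > 0` (GIRS Cor. 9 from Chuzhoy–Tan Thm. 1.1
gives `δ = 1/10`). Then for every locality `ℓ ≥ 1` and
depth `d` there are `ε > 0` and `R` such that for every `r ≥ R`, every `ℓ`-sparse unsolvable
system `E` over `𝔽₂` whose row supports form an `(r, 3/4 · ℓ)`-boundary expander, in which every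
variable occurs in exactly two rows or none and whose row graph is connected, forces every
depth-`d` `textbookFrege` proof of `¬(sumEncoding 1 E)` to have size `≥ 2^{r^ε}` — the conclusion
of `ExpansionForcesDepthFregeSize` on this class, now resting on structural graph theory only (the
bounded-depth Frege lower bound for grids and the reduction along subdivided walls are proved in
the tree). [cite: GalesiEtAl2023, Theorem 18 — weak-exponent form via Corollary 9] -/
theorem expansionForcesDepthFregeSize_tseitin_of_excludedGrid
    (hW : ∃ δ : ℝ, 0 < δ ∧ ∃ c : ℝ, 0 < c ∧ ∃ t₁ : ℕ, ∀ (V : Type) [Fintype V] (G : SimpleGraph V),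
      t₁ ≤ treewidth G → ∃ r : ℕ, c * (treewidth G : ℝ) ^ δ ≤ r ∧ wall r ≼ₜ G) :
    ∀ (ℓ d : ℕ), 1 ≤ ℓ → ∃ ε : ℝ, 0 < ε ∧ ∃ R : ℝ, ∀ r : ℝ, R ≤ r →
      ∀ (n m : ℕ) (E : Fin m → LinEqMod 2 n), (∀ i, (E i).supp.card ≤ ℓ) →
      IsBoundaryExpander (fun i => (E i).supp.map Fin.valEmbedding) r (3 / 4 * ℓ) →
      ¬ SystemSat E Finset.univ →
      (∀ j : Fin n, (univ.filter fun i => j ∈ (E i).supp).card = 2 ∨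
        (univ.filter fun i => j ∈ (E i).supp).card = 0) →
      ∀ G : SimpleGraph (Fin m),
        (∀ i i' : Fin m, G.Adj i i' ↔ i ≠ i' ∧ ((E i).supp ∩ (E i').supp).Nonempty) →
        G.Connected →
      ∀ π : List (PropForm ℕ),
        textbookFrege.IsDepthProofOf d π (PropForm.neg (PropForm.ofCNF (sumEncoding 1 E))) →
          (2 : ℝ) ^ (r ^ ε) ≤ (proofSize π : ℝ) :=
  expansionForcesDepthFregeSize_tseitin_of_weakTreewidthBound fun d => by
    obtain ⟨ε, hε, t₀, h⟩ := tseitin_treewidth_depthFrege_lowerBound_of_wall hW d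
    exact ⟨ε, hε, t₀, fun n m E G hcol hadj hconn htw π hπ => h ⟨hcol, hadj⟩ hconn htw π hπ⟩

end Summit.PneNP.PneNP.Theorems
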